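import Summits.QuantumFields.QCD.Theorems.WindowExtinction.Negative.SpectralFlowLocal
import Literature.Barriers.QuantumFields.WilsonDeterminantSign

/-!
# `WindowExtinction` (crux stmt-QuantumFields-8964, route `SpectralDefectExtinction`) — negative-side
# support: the spectral flow counting inequality and the window count

Definition-free extract of §5b of the standing disprover's work file
`Summits/QuantumFields/QCD/Cruxes/WindowExtinction/Disproof.lean` (cdisprove cycle 1, 2026-08-16), on top
of `SpectralFlowLocal.lean`. The Wilson statements are anchor-free (differences `n₋(m₀) − n₋(1)`); the
anchor `n₋(Γ₅ D_W(U,1,1)) = 6L⁴ = n/2` for fundamental `SU(3)` is the landed `negCount_hermitianWilson_eq`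
(`ExtinctionBuildsQCD/Negative/TightPinsLine.lean`), which turns them into statements about the index.

* `pencil_flow`: `|ν(m₁) − ν(m₂)| ≤ #{real eigenvalues λ of D with −λ ∈ [m₁, m₂]}` (algebraic multiplicity)
  for the pencil `ΓD + mΓ` — levels cross zero only at real eigenvalues of `D`, by at most the multiplicity.
* `negCount_sub_negCount_le_realModes`, `negCount_sub_anchor_le_realModes_below` (any unitary colour
  representation): the same for `H_W(m) = Γ₅ D_W(U,m,1)` and every gauge field;
  `|n₋(H_W(m₀)) − n₋(H_W(1))| ≤ #{real eigenvalues of D_W(U,0,1) that are ≤ −m₀}` for `m₀ ≤ 0`.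
* `window_realModes_ge`: `#{real modes in [t₁,t₂]} ≥ |n₋(H_W(−t₂)) − n₋(H_W(1))| − #{real modes < t₁}`
  (`t₂ ≥ 0`) —
  the pathwise form of TIGHT ∧ EXTINCT(a) of `WindowExtinction`: any witness must exhibit, per scheme
  torus, an expected `≥ 1 − ε` real modes of the massless Wilson operator inside the window
  `[−m_crit(k) − a_k m_f/Z_k, −m_crit(k) + a_k M/Z_k]` of width `→ 0` (modulo measurability of the counts).
References: Edwards–Heller–Narayanan, Nucl. Phys. B 535 (1998) 403 [hep-lat/9802016] §§1–3 (level
crossings of `γ₅W(−m)` ⟺ real modes; first crossing `m₁(β) < m_c(β)`); Horn–Johnson §4.3 (Weyl).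
-/

namespace Summit.QuantumFields.QCD.Theorems.WindowExtinction.Negative

open Matrix
open Summit.QuantumFields.QCD.Theorems.ExtinctionBuildsQCD.Negative

noncomputable section

section FlowGlobal

variable {n : Type*} [Fintype n] [DecidableEq n]

omit [DecidableEq n] in
/-- Monotonicity of `countP` in the predicate. [folklore] -/
theorem countP_mono_pred {α : Type*} (s : Multiset α) {p q : α → Prop} [DecidablePred p] [DecidablePred q]
    (h : ∀ a, p a → q a) : s.countP p ≤ s.countP q := by
  rw [Multiset.countP_eq_card_filter, Multiset.countP_eq_card_filter]
  exact Multiset.card_le_card (Multiset.monotone_filter_right s h)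

omit [DecidableEq n] in
/-- Additivity of `countP` over disjoint predicates, as an inequality. [folklore] -/
theorem countP_add_countP_le {α : Type*} (s : Multiset α) {p q r : α → Prop} [DecidablePred p]
    [DecidablePred q] [DecidablePred r] (hpq : ∀ a, p a → q a → False) (hp : ∀ a, p a → r a)
    (hq : ∀ a, q a → r a) : s.countP p + s.countP q ≤ s.countP r := by
  classical
  rw [Multiset.countP_eq_countP_filter_add s r p]
  refine add_le_add ?_ ?_
  · rw [Multiset.countP_filter]
    exact countP_mono_pred s fun a hpa => ⟨hp a hpa, hpa⟩
  · rw [Multiset.countP_filter]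
    exact countP_mono_pred s fun a hqa => ⟨hq a hqa, fun hpa => hpq a hpa hqa⟩

variable {Γ D : Matrix n n ℂ}

/-- **Spectral flow counting inequality.** For the Hermitian pencil `H(m) = ΓD + mΓ` of a
`Γ`-selfadjoint matrix `D` (`Γ` Hermitian unitary): the number of negative eigenvalues of `H` changes
between `m₁ ≤ m₂` by at most the number (with algebraic multiplicity) of REAL eigenvalues `λ` of `D`
with `−λ ∈ [m₁, m₂]` — levels of `H(m)` cross zero only at `m = −λ`, and by at most the multiplicity.
Proof: counting stability (`card_filter_lt_neg_le`) makes `ν` locally constant off the finitely many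
crossing values and bounds the jump at a crossing by the nullity `≤` algebraic multiplicity
(`pencil_zero_count_le`); induction on the number of crossing values in `[m₁, m₂]`. [folklore] -/
theorem pencil_flow (hΓ : Γᴴ = Γ) (hΓ2 : Γ * Γ = 1) (hD : (Γ * D)ᴴ = Γ * D) {m₁ m₂ : ℝ} (h12 : m₁ ≤ m₂) :
    |((Γ * D + (m₁ : ℂ) • Γ).charpoly.roots.countP (fun z => z.re < 0) : ℤ) -
        ((Γ * D + (m₂ : ℂ) • Γ).charpoly.roots.countP (fun z => z.re < 0) : ℤ)| ≤
      (D.charpoly.roots.countP (fun μ => μ.im = 0 ∧ m₁ ≤ -μ.re ∧ -μ.re ≤ m₂) : ℤ) := by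
  -- notation
  set ν : ℝ → ℕ := fun x => (Γ * D + (x : ℂ) • Γ).charpoly.roots.countP (fun z => z.re < 0) with hν
  set κ : ℝ → ℕ := fun x => (Γ * D + (x : ℂ) • Γ).charpoly.roots.countP (fun z => z.re = 0) with hκ
  set Z : ℝ → ℝ → ℕ := fun a b =>
    D.charpoly.roots.countP (fun μ => μ.im = 0 ∧ a ≤ -μ.re ∧ -μ.re ≤ b) with hZ
  change |(ν m₁ : ℤ) - (ν m₂ : ℤ)| ≤ (Z m₁ m₂ : ℤ)
  -- the finite set of crossing values
  set C : Finset ℝ := ((D.charpoly.roots.filter fun μ => μ.im = 0).map fun μ => -μ.re).toFinset with hC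
  have hmemC : ∀ x : ℝ, 0 < D.charpoly.roots.count (-(x : ℂ)) → x ∈ C := by
    intro x hx
    rw [hC, Multiset.mem_toFinset, Multiset.mem_map]
    exact ⟨-(x : ℂ), Multiset.mem_filter.2 ⟨Multiset.count_pos.1 hx, by simp⟩, by simp⟩
  have hκ0 : ∀ x : ℝ, x ∉ C → κ x = 0 := by
    intro x hx
    have h := pencil_zero_count_le hΓ hΓ2 hD x
    have : D.charpoly.roots.count (-(x : ℂ)) = 0 := by
      by_contra hne
      exact hx (hmemC x (Nat.pos_of_ne_zero hne))
    simpa [hκ, this] using h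
  have hκZ : ∀ a b x : ℝ, a ≤ x → x ≤ b → κ x ≤ Z a b := by
    intro a b x hax hxb
    refine (pencil_zero_count_le hΓ hΓ2 hD x).trans ?_
    change D.charpoly.roots.countP (fun μ => -(x : ℂ) = μ) ≤ _
    refine countP_mono_pred _ fun μ hμ => ?_
    rw [← hμ]
    simp [hax, hxb]
  -- local step packaged: near every x, ν stays in [ν x, ν x + κ x]
  have hloc : ∀ x : ℝ, ∃ ε : ℝ, 0 < ε ∧ ∀ y : ℝ, |y - x| < ε → ν x ≤ ν y ∧ ν y ≤ ν x + κ x := by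
    intro x
    obtain ⟨ε, hε, hstep⟩ := pencil_local hΓ hΓ2 hD x
    refine ⟨ε, hε, fun y hy => ?_⟩
    have := hstep (y - x) hy
    rw [show x + (y - x) = y by ring] at this
    exact ⟨this.1, this.2.2⟩
  -- constancy on crossing-free intervals
  have hconst : ∀ a b : ℝ, a ≤ b → (∀ x, a ≤ x → x ≤ b → x ∉ C) → ν a = ν b := by
    intro a b hab hfree
    have hcont : ContinuousOn ν (Set.Icc a b) := by
      intro x hx
      obtain ⟨ε, hε, hε'⟩ := hloc x
      have hk : κ x = 0 := hκ0 x (hfree x hx.1 hx.2)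
      have heq : ν =ᶠ[nhds x] fun _ => ν x := by
        rw [Filter.eventuallyEq_iff_exists_mem]
        refine ⟨Metric.ball x ε, Metric.ball_mem_nhds x hε, fun y hy => ?_⟩
        have := hε' y (by simpa [Real.dist_eq] using hy)
        show ν y = ν x
        omega
      exact ((continuousAt_congr heq).2 continuousAt_const).continuousWithinAt
    exact isPreconnected_Icc.constant hcont (Set.left_mem_Icc.2 hab) (Set.right_mem_Icc.2 hab)
  -- main induction on the number of crossing values in [m₁, b]
  suffices hmain : ∀ k : ℕ, ∀ b : ℝ, m₁ ≤ b → (C.filter fun c => m₁ ≤ c ∧ c ≤ b).card ≤ k →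
      |(ν m₁ : ℤ) - (ν b : ℤ)| ≤ (Z m₁ b : ℤ) from hmain _ m₂ h12 le_rfl
  intro k
  induction k with
  | zero =>
    intro b hb hcard
    have hfree : ∀ x, m₁ ≤ x → x ≤ b → x ∉ C := by
      intro x h1 h2 hx
      have : x ∈ C.filter fun c => m₁ ≤ c ∧ c ≤ b := Finset.mem_filter.2 ⟨hx, h1, h2⟩
      rw [Nat.le_zero, Finset.card_eq_zero] at hcard
      rw [hcard] at this
      exact absurd this (Finset.notMem_empty _)
    rw [hconst m₁ b hb hfree, sub_self, abs_zero]
    positivity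
  | succ k ih =>
    intro b hb hcard
    by_cases hempty : (C.filter fun c => m₁ ≤ c ∧ c ≤ b) = ∅
    · have hfree : ∀ x, m₁ ≤ x → x ≤ b → x ∉ C := by
        intro x h1 h2 hx
        have : x ∈ C.filter fun c => m₁ ≤ c ∧ c ≤ b := Finset.mem_filter.2 ⟨hx, h1, h2⟩
        rw [hempty] at this
        exact absurd this (Finset.notMem_empty _)
      rw [hconst m₁ b hb hfree, sub_self, abs_zero]
      positivity
    -- the largest crossing value c in [m₁, b]
    have hne : (C.filter fun c => m₁ ≤ c ∧ c ≤ b).Nonempty := Finset.nonempty_iff_ne_empty.2 hempty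
    set c := (C.filter fun c => m₁ ≤ c ∧ c ≤ b).max' hne with hc
    have hcmem : c ∈ C.filter fun c => m₁ ≤ c ∧ c ≤ b := Finset.max'_mem _ hne
    have hc1 : m₁ ≤ c := (Finset.mem_filter.1 hcmem).2.1
    have hc2 : c ≤ b := (Finset.mem_filter.1 hcmem).2.2
    have hcmax : ∀ x ∈ C, m₁ ≤ x → x ≤ b → x ≤ c := fun x hx h1 h2 =>
      Finset.le_max' _ x (Finset.mem_filter.2 ⟨hx, h1, h2⟩)
    obtain ⟨ε, hε, hε'⟩ := hloc c
    -- right part: ν b ∈ [ν c, ν c + κ c]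
    have hright : ν c ≤ ν b ∧ ν b ≤ ν c + κ c := by
      rcases hc2.lt_or_eq with hlt | heq
      · -- pick a point just right of c
        set η := min (ε / 2) (b - c) with hη
        have hηpos : 0 < η := lt_min (by linarith) (by linarith)
        have hηε : η < ε := (min_le_left _ _).trans_lt (by linarith)
        have h1 := hε' (c + η) (by rw [add_sub_cancel_left, abs_of_pos hηpos]; exact hηε)
        have h2 : ν (c + η) = ν b := hconst (c + η) b (by linarith [min_le_right (ε / 2) (b - c)])
          (fun x hx1 hx2 hxC => by
            have := hcmax x hxC (by linarith) hx2
            linarith)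
        rw [← h2]
        exact h1
      · rw [← heq]
        exact ⟨le_rfl, Nat.le_add_right _ _⟩
    rcases hc1.lt_or_eq with hlt1 | heq1
    · -- left part via the induction hypothesis on [m₁, c - η]
      -- distance to crossing values strictly left of c
      have hgapC : ∃ δ : ℝ, 0 < δ ∧ ∀ x ∈ C, x < c → x ≤ c - δ := by
        by_cases hne' : (C.filter fun x => x < c).Nonempty
        · set c' := (C.filter fun x => x < c).max' hne' with hc'
          have hc'lt : c' < c := (Finset.mem_filter.1 (Finset.max'_mem _ hne')).2
          refine ⟨c - c', by linarith, fun x hx hxc => ?_⟩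
          have hxmem : x ∈ C.filter fun x => x < c := Finset.mem_filter.2 ⟨hx, hxc⟩
          have := Finset.le_max' _ x hxmem
          linarith
        · refine ⟨1, one_pos, fun x hx hxc => ?_⟩
          exact absurd (⟨x, Finset.mem_filter.2 ⟨hx, hxc⟩⟩ : (C.filter fun x => x < c).Nonempty) hne'
      obtain ⟨δ, hδ, hδ'⟩ := hgapC
      set η := min (min (ε / 2) (δ / 2)) ((c - m₁) / 2) with hη
      have hηpos : 0 < η := lt_min (lt_min (by linarith) (by linarith)) (by linarith)
      have hηε : η < ε := ((min_le_left _ _).trans (min_le_left _ _)).trans_lt (by linarith)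
      have hηδ : η < δ := ((min_le_left _ _).trans (min_le_right _ _)).trans_lt (by linarith)
      have hηm : m₁ ≤ c - η := by
        have := min_le_right (min (ε / 2) (δ / 2)) ((c - m₁) / 2)
        linarith
      -- ν (c - η) ∈ [ν c, ν c + κ c]
      have hleft := hε' (c - η) (by rw [sub_sub_cancel_left, abs_neg, abs_of_pos hηpos]; exact hηε)
      -- crossing values in [m₁, c - η] are those of [m₁, b] minus c
      have hsub : (C.filter fun x => m₁ ≤ x ∧ x ≤ c - η) ⊂ C.filter fun x => m₁ ≤ x ∧ x ≤ b := by
        rw [Finset.ssubset_iff_of_subset]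
        · refine ⟨c, hcmem, fun hcin => ?_⟩
          have := (Finset.mem_filter.1 hcin).2.2
          linarith
        · intro x hx
          have hx' := Finset.mem_filter.1 hx
          exact Finset.mem_filter.2 ⟨hx'.1, hx'.2.1, by linarith [hx'.2.2]⟩
      have hcard' : (C.filter fun x => m₁ ≤ x ∧ x ≤ c - η).card ≤ k := by
        have := Finset.card_lt_card hsub
        omega
      have hIH := ih (c - η) hηm hcard'
      -- Z additivity: Z m₁ (c - η) + κ c ≤ Z m₁ b
      have hZadd : Z m₁ (c - η) + κ c ≤ Z m₁ b := by
        refine (add_le_add le_rfl (pencil_zero_count_le hΓ hΓ2 hD c)).trans ?_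
        change D.charpoly.roots.countP _ + D.charpoly.roots.countP (fun μ => -(c : ℂ) = μ) ≤ _
        refine countP_add_countP_le _ (fun μ h1 h2 => ?_) (fun μ h1 => ?_) (fun μ h2 => ?_)
        · rw [← h2] at h1
          simp at h1
          linarith [h1.2]
        · exact ⟨h1.1, h1.2.1, by linarith [h1.2.2]⟩
        · rw [← h2]
          simp [hc1, hc2]
      -- combine
      have e1 : |(ν m₁ : ℤ) - (ν (c - η) : ℤ)| ≤ (Z m₁ (c - η) : ℤ) := hIH
      have e2 : |(ν (c - η) : ℤ) - (ν b : ℤ)| ≤ (κ c : ℤ) := by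
        rw [abs_le]
        constructor <;> omega
      calc |(ν m₁ : ℤ) - (ν b : ℤ)| = |((ν m₁ : ℤ) - ν (c - η)) + ((ν (c - η) : ℤ) - ν b)| := by ring_nf
        _ ≤ |(ν m₁ : ℤ) - ν (c - η)| + |(ν (c - η) : ℤ) - ν b| := abs_add_le _ _
        _ ≤ (Z m₁ (c - η) : ℤ) + (κ c : ℤ) := add_le_add e1 e2
        _ ≤ (Z m₁ b : ℤ) := by exact_mod_cast hZadd
    · -- c = m₁: only the jump at c
      have hκle : κ c ≤ Z m₁ b := hκZ m₁ b c hc1 hc2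
      rw [← heq1] at hright hκle
      rw [abs_le]
      constructor <;> omega

end FlowGlobal

section WilsonFlow

open Literature.MathematicalPhysics.QuantumLattice Literature.MathematicalPhysics.QuantumFieldTheory
  Literature.Probability.LatticeModels

variable {L N : ℕ} [NeZero L] {G : Type*} [Group G] (ρ : G →* Matrix (Fin N) (Fin N) ℂ)

/-- `Γ₅ D_W(U,m,1) = Γ₅ D_W(U,0,1) + m Γ₅` (the bare mass enters additively). [folklore] -/
theorem hermitianWilsonDirac_eq_pencil (hρ : ∀ g, ρ g ∈ Matrix.unitaryGroup (Fin N) ℂ)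
    (U : GaugeConfig 4 L G) (m : ℝ) :
    spinorLift gammaFive * wilsonDirac ρ U m 1 =
      spinorLift gammaFive * wilsonDirac ρ U 0 1 + (m : ℂ) • (spinorLift gammaFive : Matrix _ _ ℂ) := by
  have h : wilsonDirac ρ U m 1 = wilsonDirac ρ U 0 1 + (m : ℂ) • (1 : Matrix _ _ ℂ) := by
    rw [wilsonDirac_eq_sub_sum_wilsonHop ρ hρ U m, wilsonDirac_eq_sub_sum_wilsonHop ρ hρ U 0,
      sub_add_eq_add_sub, ← add_smul, ← Complex.ofReal_add, zero_add, add_comm 4 m]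
  rw [h, mul_add, Matrix.mul_smul, mul_one]

/-- **Spectral flow inequality for Wilson fermions (every gauge field, every unitary colour
representation).** For bare masses `m₁ ≤ m₂`, the number `n₋` of negative eigenvalues of the Hermitian
Wilson–Dirac operator `H_W(m) = Γ₅ D_W(U,m,1)` changes between `m₁` and `m₂` by at most the number
(algebraic multiplicity) of REAL eigenvalues `λ` of the massless operator `D_W(U,0,1)` with `−λ ∈ [m₁, m₂]`:
levels of `H_W` cross zero exactly at `m = −λ` ("level crossing ⟺ real mode", Edwards–Heller–Narayanan),
by at most the multiplicity. [folklore] -/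
theorem negCount_sub_negCount_le_realModes (hρ : ∀ g, ρ g ∈ Matrix.unitaryGroup (Fin N) ℂ)
    (U : GaugeConfig 4 L G) {m₁ m₂ : ℝ} (h12 : m₁ ≤ m₂) :
    |((spinorLift gammaFive * wilsonDirac ρ U m₁ 1).charpoly.roots.countP (fun z : ℂ => z.re < 0) : ℤ) -
        ((spinorLift gammaFive * wilsonDirac ρ U m₂ 1).charpoly.roots.countP (fun z : ℂ => z.re < 0) : ℤ)| ≤
      ((wilsonDirac ρ U 0 1).charpoly.roots.countP
        (fun μ : ℂ => μ.im = 0 ∧ m₁ ≤ -μ.re ∧ -μ.re ≤ m₂) : ℤ) := by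
  rw [hermitianWilsonDirac_eq_pencil ρ hρ U m₁, hermitianWilsonDirac_eq_pencil ρ hρ U m₂]
  exact pencil_flow Literature.Barriers.QuantumFields.WilsonDeterminant.conjTranspose_spinorLift_gammaFive
    spinorLift_gammaFive_mul_self
    (Literature.Barriers.QuantumFields.WilsonDeterminant.isHermitian_hermitianWilsonDirac ρ hρ U 0 1) h12

/-- **The index is carried by the real modes below.** For `m₀ ≤ 0` and every gauge field:
`|n₋(Γ₅ D_W(U,m₀,1)) − n₋(Γ₅ D_W(U,1,1))| ≤ #{real eigenvalues λ of D_W(U,0,1) with λ ≤ −m₀}`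
(algebraic multiplicity). The anchor `n₋(Γ₅ D_W(U,1,1)) = n/2 = 6L⁴` (fundamental `SU(3)`; bare mass
`1 > 0` lies below the Wilson hole) is the landed `negCount_hermitianWilson_eq`
(`ExtinctionBuildsQCD/Negative/TightPinsLine.lean`), so the left side is `|index(m₀)|`. [folklore] -/
theorem negCount_sub_anchor_le_realModes_below (hρ : ∀ g, ρ g ∈ Matrix.unitaryGroup (Fin N) ℂ)
    (U : GaugeConfig 4 L G) {m₀ : ℝ} (hm₀ : m₀ ≤ 0) :
    |((spinorLift gammaFive * wilsonDirac ρ U m₀ 1).charpoly.roots.countP (fun z : ℂ => z.re < 0) : ℤ) -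
        ((spinorLift gammaFive * wilsonDirac ρ U 1 1).charpoly.roots.countP (fun z : ℂ => z.re < 0) : ℤ)| ≤
      ((wilsonDirac ρ U 0 1).charpoly.roots.countP (fun μ : ℂ => μ.im = 0 ∧ μ.re ≤ -m₀) : ℤ) := by
  have h := negCount_sub_negCount_le_realModes ρ hρ U (show m₀ ≤ 1 by linarith)
  refine h.trans ?_
  have hle : (wilsonDirac ρ U 0 1).charpoly.roots.countP
        (fun μ : ℂ => μ.im = 0 ∧ m₀ ≤ -μ.re ∧ -μ.re ≤ 1) ≤
      (wilsonDirac ρ U 0 1).charpoly.roots.countP (fun μ : ℂ => μ.im = 0 ∧ μ.re ≤ -m₀) :=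
    countP_mono_pred _ fun μ hμ => ⟨hμ.1, by linarith [hμ.2.1]⟩
  exact_mod_cast hle

/-- **Window count (pathwise form of TIGHT ∧ EXTINCT(a) of `WindowExtinction`).** For thresholds
`t₁, t₂` with `0 ≤ t₂` and every gauge field: the number of real eigenvalues of `D_W(U,0,1)` in the WINDOW
`[t₁, t₂]` is at least `|n₋(Γ₅D_W(U,−t₂,1)) − n₋(Γ₅D_W(U,1,1))| − #{real eigenvalues < t₁}`, where the
subtracted anchor is `6L⁴ = n/2` for fundamental `SU(3)` (`negCount_hermitianWilson_eq`), i.e. the first term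
is the modulus of the spectral index at bare mass `−t₂`. In the crux (`t₁ = −m_crit(k) − a_k m_f/Z_k`,
`t₂ = −m_crit(k) + a_k M/Z_k`, `≥ 0` eventually by the landed `Tight.eventually_probe_mem`): TIGHT makes the
phase-quenched mean of the index term `≥ 1` on the scheme torus, EXTINCT(a) at `S = L_k` makes the mean of
the last term `≤ ε`; hence — modulo measurability of the three counts, which a prover owes anyway — any
witness of `WindowExtinction` has `E₊[#{real modes of D_W(U,0,1) in [−m_crit(k) − a_k m_f/Z_k,
−m_crit(k) + a_k M/Z_k]}] ≥ 1 − ε` eventually: a REAL-MODE ACCUMULATION EDGE at `−m_crit(k)`, sharp to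
`a_k(m_f + M)/Z_k → 0` (EHN's first-crossing point `m₁(β)`). [folklore] -/
theorem window_realModes_ge (hρ : ∀ g, ρ g ∈ Matrix.unitaryGroup (Fin N) ℂ)
    (U : GaugeConfig 4 L G) {t₁ t₂ : ℝ} (ht₂ : 0 ≤ t₂) :
    |((spinorLift gammaFive * wilsonDirac ρ U (-t₂) 1).charpoly.roots.countP (fun z : ℂ => z.re < 0) : ℤ) -
        ((spinorLift gammaFive * wilsonDirac ρ U 1 1).charpoly.roots.countP (fun z : ℂ => z.re < 0) : ℤ)| -
      ((wilsonDirac ρ U 0 1).charpoly.roots.countP (fun μ : ℂ => μ.im = 0 ∧ μ.re < t₁) : ℤ) ≤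
      ((wilsonDirac ρ U 0 1).charpoly.roots.countP
        (fun μ : ℂ => μ.im = 0 ∧ t₁ ≤ μ.re ∧ μ.re ≤ t₂) : ℤ) := by
  have h := negCount_sub_anchor_le_realModes_below ρ hρ U (show -t₂ ≤ 0 by linarith)
  rw [neg_neg] at h
  have hsplit : (wilsonDirac ρ U 0 1).charpoly.roots.countP (fun μ : ℂ => μ.im = 0 ∧ μ.re ≤ t₂) ≤
      (wilsonDirac ρ U 0 1).charpoly.roots.countP (fun μ : ℂ => μ.im = 0 ∧ μ.re < t₁) +
        (wilsonDirac ρ U 0 1).charpoly.roots.countP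
          (fun μ : ℂ => μ.im = 0 ∧ t₁ ≤ μ.re ∧ μ.re ≤ t₂) := by
    rw [Multiset.countP_eq_countP_filter_add _ _ (fun μ : ℂ => μ.re < t₁), Multiset.countP_filter,
      Multiset.countP_filter]
    refine add_le_add (countP_mono_pred _ fun μ hμ => ⟨hμ.1.1, hμ.2⟩)
      (countP_mono_pred _ fun μ hμ => ⟨hμ.1.1, not_lt.1 hμ.2, hμ.1.2⟩)
  have : ((wilsonDirac ρ U 0 1).charpoly.roots.countP (fun μ : ℂ => μ.im = 0 ∧ μ.re ≤ t₂) : ℤ) ≤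
      ((wilsonDirac ρ U 0 1).charpoly.roots.countP (fun μ : ℂ => μ.im = 0 ∧ μ.re < t₁) : ℤ) +
        ((wilsonDirac ρ U 0 1).charpoly.roots.countP
          (fun μ : ℂ => μ.im = 0 ∧ t₁ ≤ μ.re ∧ μ.re ≤ t₂) : ℤ) := by
    exact_mod_cast hsplit
  linarith

end WilsonFlow

end

end Summit.QuantumFields.QCD.Theorems.WindowExtinction.Negative
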